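import Summits.BirchSwinnertonDyer.BirchSwinnertonDyer.Theses.ResidualThetaTransportAtTwo
import Summits.BirchSwinnertonDyer.BirchSwinnertonDyer.Theorems.ResidualThetaTransportAtTwoSignedMuVanishingAtTwoPlusLineV42
import Summits.BirchSwinnertonDyer.BirchSwinnertonDyer.Theorems.ResidualThetaTransportAtTwoSignedMuPropagationAtTwoR
import Summits.BirchSwinnertonDyer.BirchSwinnertonDyer.Theorems.ThetaPartnerAtTwoSignedControlAtTwoSignedEulerCharCount
import Summits.BirchSwinnertonDyer.BirchSwinnertonDyer.Theorems.ThetaPartnerAtTwoSignedControlAtTwoPlusLocalInjOfHonda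
import Summits.BirchSwinnertonDyer.BirchSwinnertonDyer.Theorems.ThetaPartnerAtTwoSignedControlAtTwoLocalNonDivTwo
import Summits.BirchSwinnertonDyer.BirchSwinnertonDyer.Theorems.QuadraticBranchSignedControlPlusEtaBottomLayerFinite
import Literature.NumberTheory.EllipticCurves.Kobayashi2003.SignedSelmerDualExistsProofs
import HarnessLib

/-!
# Route `ResidualThetaTransportAtTwo`, crux Kμ⁺ `SignedMuVanishingAtTwoPlus` (stmt-BirchSwinnertonDyer-20689):
# a CERTIFICATE ROAD for the algebraic half — «trivial plus Selmer group»: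
# INJ⁺@2 ∧ `Sel_{2^∞}(A/ℚ) = 0` ∧ `2 ∤ Tam(A)` ⟹ `Sel⁺(A/ℚ_∞) = 0` ⟹ `X⁺_A = 0` ⟹ the seed child 21438 for
# every habitat⁺ curve `W ≡ A (mod 2)`

Cell `bsd-wall`, width seat `bsd-wall-rtt-p4-w2` (g2) on the lead line `birth` v4.2 of the crux (skeleton
`Cruxes/SignedMuVanishingAtTwoPlus/Lines/birth.lean`: the propagation stub is PROVED, the crux is kernel-exactly
«child 21437 ∧ child 21438», lead g3's `…LineV42`; 21438 = `SignedMuSeedAtTwoPlus` was recorded as «conjecture-grade,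
NO per-class certificate road for the algebraic side»). THIS FILE SUPPLIES THAT ROAD. THEOREMS ONLY (no `def`, no named
fact, no `sorry`); helper `--supports` the crux; nothing about any particular curve is asserted; BSD is not proved by this.

## What is proved

* §1 (any number field `K`, prime `p`, `ℤ_p`-extension `κ`, sign `ε`, topological generator `γ`)
  `signedSelmerInfty_eq_bot_of_forall_mem_endInvariants_eq_zero`: **`(Sel^ε(E/K_∞))^γ = 0 ⟹ Sel^ε(E/K_∞) = 0`** —
  `conj_γ − 1` is locally nilpotent on Kobayashi's signed Selmer group (tree `isLocNil_conjSignedSelmerInfty_sub_one`)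
  and an injective locally nilpotent endomorphism lives on the zero group (tree `EtaBottomLayer.eq_zero_of_isLocNil_of_ker_trivial`,
  Greenberg LNM 1716 p. 94 fact (1) dualised: neither Nakayama nor finite generation is used); hence `X^ε = 0` for EVERY
  Pontryagin-dual datum (`subsingleton_X_of_signedSelmerInfty_eq_bot`), so `X^ε` is finitely generated, `Λ`-torsion, with
  `μ = 0` (`isTorsion_and_mu_eq_zero_of_signedSelmerInfty_eq_bot`, through seat w2's
  `isTorsion_and_mu_eq_zero_iff_finite_selmer_pTorsion`).
* §2 (`K = ℚ`, `κ` cyclotomic, any `p`, either sign) `signedSelmerInfty_eq_bot_of_localInj_of_selmerGroupPInfty_eq_bot`: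
  **«`r_p^ε` injective» ∧ `E(ℚ)[p] = 0` ∧ `Sel_{p^∞}(E/ℚ) = 0` ∧ `p ∤ ∏ c_ℓ` ⟹ `Sel^ε(E/ℚ_∞) = 0`** — Greenberg's
  Prop. 3.8 for Kobayashi's signed structure: the lead tp2-p3's ONE-SIDED count
  `SignedEC.natCard_signedSelmerInvariants_mul_dvd_of_localInj` (`#(Sel^ε_∞)^γ · #E[p^∞]^{Γ_ℚ} ∣ #Sel_{p^∞}(E/ℚ) · p^{ord_p ∏ c_ℓ}`,
  NO Poitou–Tate, NO printed fact) makes `(Sel^ε_∞)^γ` a finite group of order `1`, and §1 applies. At `p = 2` on a good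
  supersingular curve `E(ℚ)[2] = 0` is a theorem (`SignedEC.natCard_fixedPoints_geomPrimaryTorsion_two_eq_one`):
  `signedSelmerInfty_two_eq_bot_of_localInj` and, with INJ⁺@2 DISCHARGED by a plus Honda system at `2`
  (seat tp2-p3-w3's `SignedEC.plusLocalInj_two_of_honda` + LEV0@2 `…exists_mem_localLayerPointsOfEmb_zero_ne_two_nsmul`),
  `signedSelmerInfty_two_eq_bot_of_honda` — the hypothesis is exactly the registered research stub HONDA⁺@2 of K4
  `SignedControlAtTwo` (line `eulerchar` v6), a conjunct of THIS route's own cone, read for the curve `A`.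
* §3 THE SEED CERTIFICATE (items 21438 / 20689): for a habitat⁺ curve `W` (good supersingular at `2`, `a₂ = 0`, `Δ_W < 0`)
  and a partner `A` (good supersingular at `2`, `a₂(A) = 0`, `W[2] ≃ A[2]` Galois-equivariantly — `A := W` allowed) with
  `Sel⁺(A/ℚ_∞) = 0` at every cyclotomic `κ`, the PROVED propagation item 22891 (`signedMuPropagationAtTwoR_proof`) gives
  conjunct 1 of Kμ⁺ at `W` (`muAlgebraicAt_of_partner_signedSelmerInfty_eq_bot`); in certificate form
  `muAlgebraicAt_of_partner_descentCertificate` (INJ⁺@2(A) ∧ `Sel_{2^∞}(A/ℚ) = 0` ∧ `2 ∤ Tam(A)`) and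
  `muAlgebraicAt_of_partner_honda_descentCertificate` (HONDA⁺@2(A) in place of INJ⁺@2(A)). Globally:
  `signedMuSeedAtTwoPlus_of_descentCertificates` — **child 21438 `SignedMuSeedAtTwoPlus` BY NAME follows if every habitat⁺
  class carries ONE such certified member** — and `signedMuVanishingAtTwoPlus_of_descentCertificates_of_periodUnit_of_flatMuZero`
  (the crux BY NAME from the certificates + PER + FLAT, lead g3's `…LineV42`).

READING for the planner. 21438 was «Greenberg's `μ = 0` conjecture in the signed setting at `2` over an infinite family, no
per-class certificate». Modulo the route's OWN local input at `2` (HONDA⁺@2, kit-certified to layer 7 by the K4 lead, proof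
plan in `Cruxes/SignedControlAtTwo/LAGPLUS-AT-2-CONSTRUCTION.md`) it is now PER-CLASS CERTIFIABLE exactly like the analytic
child 21437: the certificate of a residual class `W[2]` is ONE good-supersingular `a₂ = 0` curve `A` with `A[2] ≃ W[2]`,
`Sel_{2^∞}(A/ℚ) = 0` (⟸ `Sel^{(2)}(A/ℚ) = 0`, a 2-descent: tree `selmerGroupPInfty_eq_bot_of_selmerGroup_eq_bot`; ⟸ `A(ℚ)`
finite and `2 ∤ #Ш(A)`: tree `selmerGroupPInfty_eq_bot_of_finite_of_padicValNat_card_sha`) and odd Tamagawa product — for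
the class of `19a1` the curve `19a1` itself (`Ш = 1`, `c₁₉ = 3`, `E(ℚ) ≅ ℤ/3`). This is the ALGEBRAIC twin of cell
`bsd-f1-sign2`'s open candidate `F1Sign2.FlatSignedDualTrivialOfUnitAtTwo` (ES-C-B: `X⁺ = 0` on the UNIT locus
`ord₂(L(E,1)/Ω_E) = 0`, `2 ∤ Tam`), with the 2-descent hypothesis in place of the unit `L`-value (no Kato divisibility at `2`
needed); under BSD₂ the two loci coincide.

References: R. Greenberg, LNM 1716 (1999) §3 Prop. 3.8 (pp. 95–96), p. 94 fact (1), §4 Lemmas 4.3–4.4 (pp. 103–104)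
[GreenbergLNM1716]; B. D. Kim, J. Aust. Math. Soc. 95 (2013) proof of Cor. 3.15 (pp. 199–200) [BDKim2013]; S. Kobayashi,
Invent. Math. 152 (2003) Def. 1.1, §8.4, Thm. 9.3 [Kobayashi2003]; R. Greenberg, V. Vatsal, Invent. Math. 142 (2000) p. 3,
Prop. (2.8) [GreenbergVatsal2000].
-/

set_option autoImplicit false
-- the Theorems namespace of this sub repeats the summit name by design (D-0017 nested layout)
set_option linter.dupNamespace false

noncomputable section

open scoped Classical NumberField MatrixGroups ModularForm

open NumberField IsDedekindDomain CongruenceSubgroup WeierstrassCurve Literature.NumberTheory.EllipticCurves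
  Literature.NumberTheory.GaloisRepresentations ZpExtension Literature.NumberTheory.EllipticCurves.Kobayashi2003
  Literature.NumberTheory.EllipticCurves.IwasawaDual Literature.NumberTheory.EllipticCurves.IwasawaAlgebra
  Literature.NumberTheory.EllipticCurves.Rank1Residual Literature.NumberTheory.EllipticCurves.ModularForms
  Summit.BirchSwinnertonDyer.Rank1Residual.Supersingular Summit.BirchSwinnertonDyer.Rank1Residual.X1
  Summit.BirchSwinnertonDyer.BirchSwinnertonDyer.Theses.ResidualThetaTransportAtTwo

universe u

namespace Summit.BirchSwinnertonDyer.BirchSwinnertonDyer.Theorems.SignedMuAtTwo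

/-! ## §1 Any number field, prime and sign: trivial invariants ⟹ trivial signed Selmer group ⟹ `X^ε = 0` -/

section General

variable {K : Type u} [Field K] [NumberField K] (W : WeierstrassCurve K) {p : ℕ} [Fact p.Prime]
  (κ : ZpExtension K p) (ε : ℤˣ)

/-- **`(Sel^ε(E/K_∞))^γ = 0 ⟹ Sel^ε(E/K_∞) = 0`** for `γ` a topological generator of `Gal(K_∞/K)`: the endomorphism
`ψ = conj_γ − 1` of Kobayashi's `Sel^ε(E/K_∞)` is locally nilpotent (`isLocNil_conjSignedSelmerInfty_sub_one`: every class
comes from a finite layer `K_n`, is `p`-power torsion, and `(conj_γ − 1)^{k·pⁿ}` kills it), so if its kernel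
`(Sel^ε_∞)^γ = endInvariants ψ` is zero then `ψ` is injective and every class, killed by a power of `ψ`, is zero
(`EtaBottomLayer.eq_zero_of_isLocNil_of_ker_trivial`). The Pontryagin dual of Greenberg's «`X/TX = 0 ⟹ X = 0`», with
neither Nakayama's lemma nor finite generation. [cite: GreenbergLNM1716, §3 p. 94 fact (1) and Prop. 3.8 (proof, p. 96)]
[cite: Kobayashi2003, Def. 1.1 (p. 2)] -/
theorem signedSelmerInfty_eq_bot_of_forall_mem_endInvariants_eq_zero {γ : Field.absoluteGaloisGroup K}
    (hγ : κ.IsTopGenerator γ)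
    (h0 : ∀ s ∈ endInvariants (conjSignedSelmerInfty W κ ε γ - 1), s = 0) :
    signedSelmerInfty W κ ε = ⊥ := by
  have hall : ∀ s : signedSelmerInfty W κ ε, s = 0 :=
    EtaBottomLayer.eq_zero_of_isLocNil_of_ker_trivial (isLocNil_conjSignedSelmerInfty_sub_one W κ ε hγ)
      fun s hs ↦ h0 s ((mem_endInvariants_iff _ s).mpr hs)
  refine eq_bot_iff.mpr fun x hx ↦ ?_
  rw [AddSubgroup.mem_bot]
  exact congrArg Subtype.val (hall ⟨x, hx⟩)

/-- **`#(Sel^ε(E/K_∞))^γ = 1 ⟹ Sel^ε(E/K_∞) = 0`** (the counting form of the previous theorem: a group of `Nat.card` one is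
the zero group). [cite: GreenbergLNM1716, §3 Prop. 3.8 (proof, p. 96)] [cite: Kobayashi2003, Def. 1.1 (p. 2)] -/
theorem signedSelmerInfty_eq_bot_of_natCard_endInvariants_eq_one {γ : Field.absoluteGaloisGroup K}
    (hγ : κ.IsTopGenerator γ)
    (h1 : Nat.card ↥(endInvariants (conjSignedSelmerInfty W κ ε γ - 1)) = 1) :
    signedSelmerInfty W κ ε = ⊥ := by
  have hsub := (Nat.card_eq_one_iff_unique.mp h1).1
  exact signedSelmerInfty_eq_bot_of_forall_mem_endInvariants_eq_zero W κ ε hγ fun s hs ↦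
    congrArg Subtype.val (Subsingleton.elim (⟨s, hs⟩ : ↥(endInvariants (conjSignedSelmerInfty W κ ε γ - 1)))
      ⟨0, zero_mem _⟩)

variable {W κ ε}

/-- **`Sel^ε(E/K_∞) = 0 ⟹ X^ε(E/K_∞) = 0` for EVERY Pontryagin-dual datum `D`**: `D.toDual : X → Hom(Sel^ε_∞, ℚ/ℤ)` is
injective and its target is `Hom(0, ℚ/ℤ) = 0`. [cite: Kobayashi2003, Def. 1.1 and Thm. 1.2 (the object `X^±`, p. 2)] -/
theorem subsingleton_X_of_signedSelmerInfty_eq_bot {γ : Field.absoluteGaloisGroup K} (D : SignedSelmerDualData W κ γ ε)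
    (h : signedSelmerInfty W κ ε = ⊥) : Subsingleton D.X := by
  have hS : ∀ s : signedSelmerInfty W κ ε, s = 0 := fun s ↦
    Subtype.ext ((AddSubgroup.eq_bot_iff_forall _).mp h s s.2)
  refine subsingleton_of_forall_eq 0 fun x ↦ D.bijective.1 ?_
  ext s
  simp only [hS s, map_zero]

/-- The zero `Λ`-module is finitely generated: `Sel^ε(E/K_∞) = 0` discharges the `[Module.Finite Λ X]` binder of every datum.
[folklore] -/
theorem moduleFinite_of_signedSelmerInfty_eq_bot {γ : Field.absoluteGaloisGroup K} (D : SignedSelmerDualData W κ γ ε)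
    (h : signedSelmerInfty W κ ε = ⊥) : Module.Finite (IwasawaAlgebra p) D.X :=
  haveI := subsingleton_X_of_signedSelmerInfty_eq_bot D h
  haveI : Finite D.X := Finite.of_subsingleton
  Module.Finite.of_finite

/-- The zero `Λ`-module is torsion: `Sel^ε(E/K_∞) = 0 ⟹ X^ε` is `Λ`-torsion, for every datum, no binder. [folklore] -/
theorem isTorsion_of_signedSelmerInfty_eq_bot {γ : Field.absoluteGaloisGroup K} (D : SignedSelmerDualData W κ γ ε)
    (h : signedSelmerInfty W κ ε = ⊥) : Module.IsTorsion (IwasawaAlgebra p) D.X :=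
  haveI := subsingleton_X_of_signedSelmerInfty_eq_bot D h
  fun _ ↦ ⟨1, Subsingleton.elim _ _⟩

/-- **`Sel^ε(E/K_∞) = 0 ⟹ X^ε` is `Λ`-torsion with `μ(X^ε) = 0`** for every finitely generated Pontryagin-dual datum — the
conclusion shape of the algebraic conjunct of Kμ⁺ — through seat w2's `isTorsion_and_mu_eq_zero_iff_finite_selmer_pTorsion`
(torsion ∧ `μ = 0` ⟺ `Sel^ε_∞[p]` finite; the `p`-torsion of the zero group is finite).
[cite: GreenbergVatsal2000, p. 3 (proof of Thm. (1.4))] [cite: GreenbergLNM1716, §1 (p. 60)] -/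
theorem isTorsion_and_mu_eq_zero_of_signedSelmerInfty_eq_bot {γ : Field.absoluteGaloisGroup K}
    (D : SignedSelmerDualData W κ γ ε) [Module.Finite (IwasawaAlgebra p) D.X] (h : signedSelmerInfty W κ ε = ⊥) :
    Module.IsTorsion (IwasawaAlgebra p) D.X ∧ D.mu = 0 := by
  refine (isTorsion_and_mu_eq_zero_iff_finite_selmer_pTorsion D).mpr ?_
  haveI : Finite ↥(signedSelmerInfty W κ ε) := by rw [h]; infer_instance
  exact Set.toFinite _

end General

/-! ## §2 Over `ℚ` along the cyclotomic `ℤ_p`-extension: Greenberg's Prop. 3.8 for the signed structure -/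

section Rat

/-- **Greenberg's Prop. 3.8 for Kobayashi's `Sel^ε`, any prime `p`, either sign.** For `E/ℚ` and the cyclotomic
`ℤ_p`-extension: IF (i) every class of `A^ε_0 = h_0⁻¹(Sel^ε(E/ℚ_∞)) ⊆ H¹(ℚ, E[p^∞])` satisfies the classical local condition
at the place above `p` («`r_p^ε` injective», the `±` local theory; displayed), (ii) `#E(ℚ)[p^∞] = 1`, (iii)
`Sel_{p^∞}(E/ℚ) = 0` and (iv) `p ∤ ∏_ℓ c_ℓ`, THEN `Sel^ε(E/ℚ_∞) = 0`. Kernel steps: the lead tp2-p3's one-sided count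
`#(Sel^ε_∞)^γ · #E[p^∞]^{Γ_ℚ} ∣ #Sel_{p^∞}(E/ℚ) · p^{ord_p ∏ c_ℓ}` (Lemma 4.3 for `Sel^ε` and `#ker g^ε ∣ p^{ord_p ∏ c_ℓ}` under
(i); no Poitou–Tate, no printed fact) reads `#(Sel^ε_∞)^γ ∣ 1`, and §1 finishes.
[cite: GreenbergLNM1716, §3 Prop. 3.8 (pp. 95–96), §4 Lemmas 4.3–4.4 (pp. 103–104)] [cite: BDKim2013, proof of Cor. 3.15 (pp. 199–200)] -/
theorem signedSelmerInfty_eq_bot_of_localInj_of_selmerGroupPInfty_eq_bot (W : WeierstrassCurve ℚ) [W.IsElliptic]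
    (p : ℕ) [Fact p.Prime] (ε : ℤˣ) {κ : ZpExtension ℚ p} (hκ : κ.IsCyclotomic)
    (hinj : ∀ v : HeightOneSpectrum (𝓞 ℚ), (p : 𝓞 ℚ) ∈ v.asIdeal →
      ∀ y ∈ (signedSelmerInfty W κ ε).comap (W.layerToInfty κ 0),
        W.localResOver p (κ.layerSubgroup 0) (v.adicCompletion ℚ) y = 0)
    (htors : Nat.card (MulAction.fixedPoints (Field.absoluteGaloisGroup ℚ) (W.geomPrimaryTorsion p)) = 1)
    (hSel : W.selmerGroupPInfty p = ⊥) (htam : ¬ p ∣ W.tamagawaProduct) :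
    signedSelmerInfty W κ ε = ⊥ := by
  obtain ⟨γ, hγ⟩ := κ.surjective (Multiplicative.ofAdd 1)
  have hγ' : κ.IsTopGenerator γ := hγ
  have hfin : Finite (W.selmerGroupPInfty p) := by rw [hSel]; infer_instance
  obtain ⟨-, hdvd⟩ := SignedEC.natCard_signedSelmerInvariants_mul_dvd_of_localInj W p ε hκ hγ' hinj hfin
  rw [htors, mul_one, hSel, AddSubgroup.card_bot, one_mul, padicValNat.eq_zero_of_not_dvd htam, pow_zero] at hdvd
  exact signedSelmerInfty_eq_bot_of_natCard_endInvariants_eq_one W κ ε hγ' (Nat.dvd_one.mp hdvd)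

variable (W : WeierstrassCurve ℚ) [W.IsElliptic] [W.IsGloballyMinimal]

/-- **At `p = 2` on a good supersingular curve: INJ^ε@2 ∧ `Sel_{2^∞}(E/ℚ) = 0` ∧ `2 ∤ ∏ c_ℓ` ⟹ `Sel^ε(E/ℚ_∞) = 0`** along
the cyclotomic `ℤ₂`-extension (either sign): `#E(ℚ)[2^∞] = 1` is the tree theorem
`SignedEC.natCard_fixedPoints_geomPrimaryTorsion_two_eq_one` (`E[2]` irreducible at a good supersingular `2`). The displayed
local input INJ^ε@2 is, for `ε = 1`, the statement the K4 line `eulerchar` derives from its one research stub HONDA⁺@2.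
[cite: GreenbergLNM1716, §3 Prop. 3.8 (pp. 95–96)] [cite: BDKim2013, proof of Cor. 3.15 (p. 199)] [cite: Kobayashi2003, Thm. 9.3] -/
theorem signedSelmerInfty_two_eq_bot_of_localInj (hss : GoodSS W 2) (ε : ℤˣ) {κ : ZpExtension ℚ 2}
    (hκ : κ.IsCyclotomic)
    (hinj : ∀ v : HeightOneSpectrum (𝓞 ℚ), (2 : 𝓞 ℚ) ∈ v.asIdeal →
      ∀ y ∈ (signedSelmerInfty W κ ε).comap (W.layerToInfty κ 0),
        W.localResOver 2 (κ.layerSubgroup 0) (v.adicCompletion ℚ) y = 0)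
    (hSel : W.selmerGroupPInfty 2 = ⊥) (htam : ¬ 2 ∣ W.tamagawaProduct) :
    signedSelmerInfty W κ ε = ⊥ :=
  signedSelmerInfty_eq_bot_of_localInj_of_selmerGroupPInfty_eq_bot W 2 ε hκ hinj
    (SignedEC.natCard_fixedPoints_geomPrimaryTorsion_two_eq_one W hss) hSel htam

/-- **At `p = 2`, plus sign, with INJ⁺@2 DISCHARGED by a plus Honda system at `2`.** For `E/ℚ` globally minimal, good
supersingular at `2`, the cyclotomic `ℤ₂`-extension `κ`: IF at the place `v ∋ 2` there is a family `d_m ∈ E(ℚ_{2,m}·ℚ_v)` with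
Kobayashi's trace relations `Tr_{m+2/m+1} d_{m+2} = −d_m`, generating each layer modulo the previous one and modulo `2` under
`Γ_{ℚ_v}`, `d_0` generating `E(ℚ_v)/2` (HONDA⁺@2 — the registered research stub `stub_plusHondaSystemTwo` of K4
`SignedControlAtTwo`, line `eulerchar` v6, read for THIS curve), AND `Sel_{2^∞}(E/ℚ) = 0`, AND `2 ∤ ∏ c_ℓ`, THEN
`Sel⁺(E/ℚ_∞) = 0`. INJ⁺@2 ⟸ HONDA⁺@2 + LEV0@2 is seat tp2-p3-w3's `SignedEC.plusLocalInj_two_of_honda`, LEV0@2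
(`E(ℚ_v) ⊄ 2E(ℚ_v)`) its `SignedEC.exists_mem_localLayerPointsOfEmb_zero_ne_two_nsmul`.
[cite: Kobayashi2003, §8.4 (Lemma 8.9, Props. 8.11–8.12), Thm. 9.3] [cite: GreenbergLNM1716, §3 Prop. 3.8 (pp. 95–96)] -/
theorem signedSelmerInfty_two_eq_bot_of_honda (hss : GoodSS W 2) {κ : ZpExtension ℚ 2} (hκ : κ.IsCyclotomic)
    (hHonda : ∀ (v : HeightOneSpectrum (𝓞 ℚ)), (2 : 𝓞 ℚ) ∈ v.asIdeal →
      ∃ d : ℕ → localPoints W (v.adicCompletion ℚ),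
        (∀ m, d m ∈ localLayerPointsOfEmb κ (closureEmb (K := ℚ) (v.adicCompletion ℚ)) W m) ∧
        (∀ m, localTraceOfEmb κ (closureEmb (K := ℚ) (v.adicCompletion ℚ)) W (m + 1) (m + 2) (d (m + 2)) = -d m) ∧
        (∀ m : ℕ, 1 ≤ m → ∀ P ∈ localLayerPointsOfEmb κ (closureEmb (K := ℚ) (v.adicCompletion ℚ)) W m,
          ∃ B ∈ AddSubgroup.closure (Set.range fun σ : Field.absoluteGaloisGroup (v.adicCompletion ℚ) ↦ σ • d m),
            ∃ P' ∈ localLayerPointsOfEmb κ (closureEmb (K := ℚ) (v.adicCompletion ℚ)) W (m - 1),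
            ∃ R ∈ localLayerPointsOfEmb κ (closureEmb (K := ℚ) (v.adicCompletion ℚ)) W m, P = B + P' + 2 • R) ∧
        (∀ P ∈ localLayerPointsOfEmb κ (closureEmb (K := ℚ) (v.adicCompletion ℚ)) W 0,
          ∃ a : ℤ, ∃ R ∈ localLayerPointsOfEmb κ (closureEmb (K := ℚ) (v.adicCompletion ℚ)) W 0, P = a • d 0 + 2 • R))
    (hSel : W.selmerGroupPInfty 2 = ⊥) (htam : ¬ 2 ∣ W.tamagawaProduct) :
    signedSelmerInfty W κ 1 = ⊥ := by
  refine signedSelmerInfty_two_eq_bot_of_localInj W hss 1 hκ (fun v hv ↦ ?_) hSel htam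
  obtain ⟨d, hd, htr, hgen, hgen0⟩ := hHonda v hv
  exact SignedEC.plusLocalInj_two_of_honda W hss hκ v hv
    (SignedEC.exists_mem_localLayerPointsOfEmb_zero_ne_two_nsmul W κ v hv) d hd htr hgen hgen0

end Rat

/-! ## §3 The SEED CERTIFICATE for the crux Kμ⁺ and its child 21438 -/

section Seed

variable (W A : WeierstrassCurve ℚ) [W.IsElliptic] [W.IsGloballyMinimal] [A.IsElliptic] [A.IsGloballyMinimal]

/-- **Conjunct 1 of Kμ⁺ at a habitat⁺ curve `W` from a partner with TRIVIAL plus Selmer group.** `W` good supersingular at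
`2` with `a₂ = 0` and `Δ_W < 0`; `A` good supersingular at `2` with `a₂(A) = 0` and `W[2] ≃ A[2]` Galois-equivariantly
(`A := W` allowed); if `Sel⁺(A/ℚ_∞) = 0` for every cyclotomic `κ`, then every finitely generated `+` signed Selmer dual of `W`
over `ℚ_∞` is `Λ`-torsion with `μ = 0` — §1 for `A` and the PROVED propagation item 22891 `signedMuPropagationAtTwoR_proof`
(width seat rtt-p4-w3's SEL2-transfer over lead tp2-p1's residual dévissage). [cite: GreenbergVatsal2000, p. 3 and Prop. (2.8)]
[cite: BDKim2009, Cor. 2.13] -/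
theorem muAlgebraicAt_of_partner_signedSelmerInfty_eq_bot (hssW : GoodSS W 2) (haW : W.frobeniusTrace 2 = 0)
    (hΔ : W.Δ < 0) (hssA : GoodSS A 2) (haA : A.frobeniusTrace 2 = 0)
    (hiso : ∃ e : WeierstrassCurve.geomTorsion W (2 : ℤ) ≃+ WeierstrassCurve.geomTorsion A (2 : ℤ),
      ∀ (σ : Field.absoluteGaloisGroup ℚ) (P : WeierstrassCurve.geomTorsion W (2 : ℤ)), e (σ • P) = σ • e P)
    (hA : ∀ κ : ZpExtension ℚ 2, κ.IsCyclotomic → signedSelmerInfty A κ 1 = ⊥) :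
    ∀ (κ : ZpExtension ℚ 2) (γ : Field.absoluteGaloisGroup ℚ), κ.IsCyclotomic → κ.IsTopGenerator γ →
      ∀ (D : SignedSelmerDualData W κ γ 1) [Module.Finite (IwasawaAlgebra 2) D.X],
        Module.IsTorsion (IwasawaAlgebra 2) D.X ∧ D.mu = 0 :=
  signedMuPropagationAtTwoR_proof W A hssW haW hΔ hssA haA hiso
    fun κ _γ hκ _hγ D _ ↦ isTorsion_and_mu_eq_zero_of_signedSelmerInfty_eq_bot D (hA κ hκ)

/-- **THE DESCENT CERTIFICATE (INJ⁺ form).** Conjunct 1 of Kμ⁺ at the habitat⁺ curve `W` holds as soon as ONE member `A` of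
its residual class (`A` good supersingular at `2`, `a₂(A) = 0`, `W[2] ≃ A[2]`; `A := W` allowed) satisfies: INJ⁺@2 at every
cyclotomic `κ` (the `+` local theory at `2`), `Sel_{2^∞}(A/ℚ) = 0`, and `2 ∤ ∏_ℓ c_ℓ(A)`.
[cite: GreenbergLNM1716, §3 Prop. 3.8 (pp. 95–96)] [cite: GreenbergVatsal2000, Prop. (2.8)] [cite: BDKim2013, proof of Cor. 3.15] -/
theorem muAlgebraicAt_of_partner_descentCertificate (hssW : GoodSS W 2) (haW : W.frobeniusTrace 2 = 0)
    (hΔ : W.Δ < 0) (hssA : GoodSS A 2) (haA : A.frobeniusTrace 2 = 0)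
    (hiso : ∃ e : WeierstrassCurve.geomTorsion W (2 : ℤ) ≃+ WeierstrassCurve.geomTorsion A (2 : ℤ),
      ∀ (σ : Field.absoluteGaloisGroup ℚ) (P : WeierstrassCurve.geomTorsion W (2 : ℤ)), e (σ • P) = σ • e P)
    (hinjA : ∀ κ : ZpExtension ℚ 2, κ.IsCyclotomic → ∀ v : HeightOneSpectrum (𝓞 ℚ), (2 : 𝓞 ℚ) ∈ v.asIdeal →
      ∀ y ∈ (signedSelmerInfty A κ 1).comap (A.layerToInfty κ 0),
        A.localResOver 2 (κ.layerSubgroup 0) (v.adicCompletion ℚ) y = 0)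
    (hSelA : A.selmerGroupPInfty 2 = ⊥) (htamA : ¬ 2 ∣ A.tamagawaProduct) :
    ∀ (κ : ZpExtension ℚ 2) (γ : Field.absoluteGaloisGroup ℚ), κ.IsCyclotomic → κ.IsTopGenerator γ →
      ∀ (D : SignedSelmerDualData W κ γ 1) [Module.Finite (IwasawaAlgebra 2) D.X],
        Module.IsTorsion (IwasawaAlgebra 2) D.X ∧ D.mu = 0 :=
  muAlgebraicAt_of_partner_signedSelmerInfty_eq_bot W A hssW haW hΔ hssA haA hiso
    fun κ hκ ↦ signedSelmerInfty_two_eq_bot_of_localInj A hssA 1 hκ (hinjA κ hκ) hSelA htamA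

/-- **THE DESCENT CERTIFICATE (HONDA form)**: as above with INJ⁺@2(A) replaced by a plus Honda system at `2` for `A` at every
cyclotomic `κ` — the K4 line's research stub HONDA⁺@2 read for the partner `A` (a conjunct of this route's own cone) — so that,
modulo that one local statement, conjunct 1 of Kμ⁺ on the residual class of `W` costs ONE 2-descent certificate
«`Sel_{2^∞}(A/ℚ) = 0 ∧ 2 ∤ Tam(A)`». [cite: Kobayashi2003, §8.4, Thm. 9.3] [cite: GreenbergLNM1716, §3 Prop. 3.8]
[cite: GreenbergVatsal2000, Prop. (2.8)] -/
theorem muAlgebraicAt_of_partner_honda_descentCertificate (hssW : GoodSS W 2) (haW : W.frobeniusTrace 2 = 0)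
    (hΔ : W.Δ < 0) (hssA : GoodSS A 2) (haA : A.frobeniusTrace 2 = 0)
    (hiso : ∃ e : WeierstrassCurve.geomTorsion W (2 : ℤ) ≃+ WeierstrassCurve.geomTorsion A (2 : ℤ),
      ∀ (σ : Field.absoluteGaloisGroup ℚ) (P : WeierstrassCurve.geomTorsion W (2 : ℤ)), e (σ • P) = σ • e P)
    (hHondaA : ∀ κ : ZpExtension ℚ 2, κ.IsCyclotomic → ∀ (v : HeightOneSpectrum (𝓞 ℚ)), (2 : 𝓞 ℚ) ∈ v.asIdeal →
      ∃ d : ℕ → localPoints A (v.adicCompletion ℚ),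
        (∀ m, d m ∈ localLayerPointsOfEmb κ (closureEmb (K := ℚ) (v.adicCompletion ℚ)) A m) ∧
        (∀ m, localTraceOfEmb κ (closureEmb (K := ℚ) (v.adicCompletion ℚ)) A (m + 1) (m + 2) (d (m + 2)) = -d m) ∧
        (∀ m : ℕ, 1 ≤ m → ∀ P ∈ localLayerPointsOfEmb κ (closureEmb (K := ℚ) (v.adicCompletion ℚ)) A m,
          ∃ B ∈ AddSubgroup.closure (Set.range fun σ : Field.absoluteGaloisGroup (v.adicCompletion ℚ) ↦ σ • d m),
            ∃ P' ∈ localLayerPointsOfEmb κ (closureEmb (K := ℚ) (v.adicCompletion ℚ)) A (m - 1),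
            ∃ R ∈ localLayerPointsOfEmb κ (closureEmb (K := ℚ) (v.adicCompletion ℚ)) A m, P = B + P' + 2 • R) ∧
        (∀ P ∈ localLayerPointsOfEmb κ (closureEmb (K := ℚ) (v.adicCompletion ℚ)) A 0,
          ∃ a : ℤ, ∃ R ∈ localLayerPointsOfEmb κ (closureEmb (K := ℚ) (v.adicCompletion ℚ)) A 0, P = a • d 0 + 2 • R))
    (hSelA : A.selmerGroupPInfty 2 = ⊥) (htamA : ¬ 2 ∣ A.tamagawaProduct) :
    ∀ (κ : ZpExtension ℚ 2) (γ : Field.absoluteGaloisGroup ℚ), κ.IsCyclotomic → κ.IsTopGenerator γ →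
      ∀ (D : SignedSelmerDualData W κ γ 1) [Module.Finite (IwasawaAlgebra 2) D.X],
        Module.IsTorsion (IwasawaAlgebra 2) D.X ∧ D.mu = 0 :=
  muAlgebraicAt_of_partner_signedSelmerInfty_eq_bot W A hssW haW hΔ hssA haA hiso
    fun κ hκ ↦ signedSelmerInfty_two_eq_bot_of_honda A hssA hκ (hHondaA κ hκ) hSelA htamA

omit [W.IsElliptic] [W.IsGloballyMinimal] [A.IsElliptic] [A.IsGloballyMinimal] in
/-- **Child 21438 `SignedMuSeedAtTwoPlus` BY NAME from descent certificates**: if every habitat⁺ curve `W` is congruent mod `2`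
to SOME good-supersingular `a₂ = 0` curve `A` carrying INJ⁺@2 at every cyclotomic `κ`, `Sel_{2^∞}(A/ℚ) = 0` and
`2 ∤ Tam(A)`, then the `μ`-seed child holds — the conjecture-grade child is PER-CLASS CERTIFIABLE modulo the `+` local theory
at `2`. [cite: GreenbergLNM1716, §3 Prop. 3.8] [cite: GreenbergVatsal2000, p. 3 (proof of Thm. (1.4))] -/
theorem signedMuSeedAtTwoPlus_of_descentCertificates
    (hcert : ∀ (W : WeierstrassCurve ℚ) [W.IsElliptic] [W.IsGloballyMinimal], ¬ W.HasCM → W.analyticRank = 0 →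
      GoodSS W 2 → W.frobeniusTrace 2 = 0 → W.Δ < 0 →
      ∃ (A : WeierstrassCurve ℚ) (_ : A.IsElliptic) (_ : A.IsGloballyMinimal), GoodSS A 2 ∧ A.frobeniusTrace 2 = 0 ∧
        (∃ e : WeierstrassCurve.geomTorsion W (2 : ℤ) ≃+ WeierstrassCurve.geomTorsion A (2 : ℤ),
          ∀ (σ : Field.absoluteGaloisGroup ℚ) (P : WeierstrassCurve.geomTorsion W (2 : ℤ)), e (σ • P) = σ • e P) ∧
        (∀ κ : ZpExtension ℚ 2, κ.IsCyclotomic → ∀ v : HeightOneSpectrum (𝓞 ℚ), (2 : 𝓞 ℚ) ∈ v.asIdeal →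
          ∀ y ∈ (signedSelmerInfty A κ 1).comap (A.layerToInfty κ 0),
            A.localResOver 2 (κ.layerSubgroup 0) (v.adicCompletion ℚ) y = 0) ∧
        A.selmerGroupPInfty 2 = ⊥ ∧ ¬ 2 ∣ A.tamagawaProduct) :
    SignedMuSeedAtTwoPlus := by
  intro W _ _ hCM hr hss ha hΔ
  obtain ⟨A, hAell, hAmin, hssA, haA, hiso, hinjA, hSelA, htamA⟩ := hcert W hCM hr hss ha hΔ
  exact ⟨A, hAell, hAmin, hssA, haA, hiso, fun κ _γ hκ _hγ D _ ↦
    isTorsion_and_mu_eq_zero_of_signedSelmerInfty_eq_bot D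
      (signedSelmerInfty_two_eq_bot_of_localInj A hssA 1 hκ (hinjA κ hκ) hSelA htamA)⟩

omit [W.IsElliptic] [W.IsGloballyMinimal] [A.IsElliptic] [A.IsGloballyMinimal] in
/-- **The crux Kμ⁺ BY NAME from descent certificates + PER + FLAT** (lead g3's `…LineV42`
`signedMuVanishingAtTwoPlus_of_seed_of_periodUnit_of_flatMuZero` fed with the previous theorem): on line `birth` v4.2 the
algebraic stub is CLOSED MODULO {INJ⁺@2 (⟸ HONDA⁺@2), one 2-descent certificate per residual class}.
[cite: GreenbergLNM1716, §3 Prop. 3.8] [cite: GreenbergVatsal2000, Prop. (2.8)] [cite: Pollack2003, Prop. 6.18] -/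
theorem signedMuVanishingAtTwoPlus_of_descentCertificates_of_periodUnit_of_flatMuZero
    (hcert : ∀ (W : WeierstrassCurve ℚ) [W.IsElliptic] [W.IsGloballyMinimal], ¬ W.HasCM → W.analyticRank = 0 →
      GoodSS W 2 → W.frobeniusTrace 2 = 0 → W.Δ < 0 →
      ∃ (A : WeierstrassCurve ℚ) (_ : A.IsElliptic) (_ : A.IsGloballyMinimal), GoodSS A 2 ∧ A.frobeniusTrace 2 = 0 ∧
        (∃ e : WeierstrassCurve.geomTorsion W (2 : ℤ) ≃+ WeierstrassCurve.geomTorsion A (2 : ℤ),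
          ∀ (σ : Field.absoluteGaloisGroup ℚ) (P : WeierstrassCurve.geomTorsion W (2 : ℤ)), e (σ • P) = σ • e P) ∧
        (∀ κ : ZpExtension ℚ 2, κ.IsCyclotomic → ∀ v : HeightOneSpectrum (𝓞 ℚ), (2 : 𝓞 ℚ) ∈ v.asIdeal →
          ∀ y ∈ (signedSelmerInfty A κ 1).comap (A.layerToInfty κ 0),
            A.localResOver 2 (κ.layerSubgroup 0) (v.adicCompletion ℚ) y = 0) ∧
        A.selmerGroupPInfty 2 = ⊥ ∧ ¬ 2 ∣ A.tamagawaProduct)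
    (hper : ∀ (W : WeierstrassCurve ℚ) [W.IsElliptic] [W.IsGloballyMinimal], GoodSS W 2 →
      ∀ [NeZero (W.conductorNorm ℤ)] (f : CuspForm (Gamma0 (W.conductorNorm ℤ)) 2), IsNewformOf W f →
      ∃ u : ℚ, ‖(u : ℚ_[2])‖ = 1 ∧ W.realPeriodRat = u * plusPeriod f)
    (hflat : ∀ (W : WeierstrassCurve ℚ) [W.IsElliptic] [W.IsGloballyMinimal], ¬ W.HasCM →
      W.analyticRank = 0 → GoodSS W 2 → W.frobeniusTrace 2 = 0 → W.Δ < 0 →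
      ∀ [NeZero (W.conductorNorm ℤ)] (f : CuspForm (Gamma0 (W.conductorNorm ℤ)) 2), IsNewformOf W f →
      ∀ (Lplus Lminus : IwasawaAlgebra 2), IsPollackPair f 2 Lplus Lminus →
      ¬ PowerSeries.C (2 : ℤ_[2]) ∣ Lminus) :
    SignedMuVanishingAtTwoPlus :=
  signedMuVanishingAtTwoPlus_of_seed_of_periodUnit_of_flatMuZero (signedMuSeedAtTwoPlus_of_descentCertificates hcert)
    hper hflat

/-- **The crux body AT ONE habitat⁺ curve `W` from ONE certificate** (the per-class closing shape of rung 1.hab⁺): a partner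
`A` with HONDA⁺@2(A), `Sel_{2^∞}(A/ℚ) = 0`, `2 ∤ Tam(A)` gives conjunct 1; the period unit at `W` (PER, Abbes–Ullmo) and
`2 ∤ L♭_f` for the newform of `W` (FLAT, one odd Ω-normalised layer coefficient) give conjunct 2 through the lead's `Λ`-glue
`mu_eq_of_isPollackPair_two_of_periodUnit_of_not_two_dvd`. [cite: GreenbergLNM1716, §3 Prop. 3.8] [cite: Pollack2003, Prop. 6.18]
[cite: Kobayashi2003, Thm. 9.3] -/
theorem signedMuVanishingAtTwoPlusAt_of_honda_descentCertificate_of_periodUnitAt_of_flatAt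
    (hssW : GoodSS W 2) (haW : W.frobeniusTrace 2 = 0) (hΔ : W.Δ < 0) (hssA : GoodSS A 2) (haA : A.frobeniusTrace 2 = 0)
    (hiso : ∃ e : WeierstrassCurve.geomTorsion W (2 : ℤ) ≃+ WeierstrassCurve.geomTorsion A (2 : ℤ),
      ∀ (σ : Field.absoluteGaloisGroup ℚ) (P : WeierstrassCurve.geomTorsion W (2 : ℤ)), e (σ • P) = σ • e P)
    (hHondaA : ∀ κ : ZpExtension ℚ 2, κ.IsCyclotomic → ∀ (v : HeightOneSpectrum (𝓞 ℚ)), (2 : 𝓞 ℚ) ∈ v.asIdeal →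
      ∃ d : ℕ → localPoints A (v.adicCompletion ℚ),
        (∀ m, d m ∈ localLayerPointsOfEmb κ (closureEmb (K := ℚ) (v.adicCompletion ℚ)) A m) ∧
        (∀ m, localTraceOfEmb κ (closureEmb (K := ℚ) (v.adicCompletion ℚ)) A (m + 1) (m + 2) (d (m + 2)) = -d m) ∧
        (∀ m : ℕ, 1 ≤ m → ∀ P ∈ localLayerPointsOfEmb κ (closureEmb (K := ℚ) (v.adicCompletion ℚ)) A m,
          ∃ B ∈ AddSubgroup.closure (Set.range fun σ : Field.absoluteGaloisGroup (v.adicCompletion ℚ) ↦ σ • d m),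
            ∃ P' ∈ localLayerPointsOfEmb κ (closureEmb (K := ℚ) (v.adicCompletion ℚ)) A (m - 1),
            ∃ R ∈ localLayerPointsOfEmb κ (closureEmb (K := ℚ) (v.adicCompletion ℚ)) A m, P = B + P' + 2 • R) ∧
        (∀ P ∈ localLayerPointsOfEmb κ (closureEmb (K := ℚ) (v.adicCompletion ℚ)) A 0,
          ∃ a : ℤ, ∃ R ∈ localLayerPointsOfEmb κ (closureEmb (K := ℚ) (v.adicCompletion ℚ)) A 0, P = a • d 0 + 2 • R))
    (hSelA : A.selmerGroupPInfty 2 = ⊥) (htamA : ¬ 2 ∣ A.tamagawaProduct)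
    (hperW : ∀ [NeZero (W.conductorNorm ℤ)] (f : CuspForm (Gamma0 (W.conductorNorm ℤ)) 2), IsNewformOf W f →
      ∃ u : ℚ, ‖(u : ℚ_[2])‖ = 1 ∧ W.realPeriodRat = u * plusPeriod f)
    (hflatW : ∀ [NeZero (W.conductorNorm ℤ)] (f : CuspForm (Gamma0 (W.conductorNorm ℤ)) 2), IsNewformOf W f →
      ∀ (Lplus Lminus : IwasawaAlgebra 2), IsPollackPair f 2 Lplus Lminus → ¬ PowerSeries.C (2 : ℤ_[2]) ∣ Lminus) :
    (∀ (κ : ZpExtension ℚ 2) (γ : Field.absoluteGaloisGroup ℚ), κ.IsCyclotomic → κ.IsTopGenerator γ →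
      ∀ (D : SignedSelmerDualData W κ γ 1) [Module.Finite (IwasawaAlgebra 2) D.X],
        Module.IsTorsion (IwasawaAlgebra 2) D.X ∧ D.mu = 0) ∧
    (∀ (γ : Field.absoluteGaloisGroup ℚ), IsCyclotomicVariable 2 γ →
      ∀ [NeZero (W.conductorNorm ℤ)] (f : CuspForm (Gamma0 (W.conductorNorm ℤ)) 2), IsNewformOf W f →
      ∀ (ϖ : ℚ), (ϖ : ℝ) * W.realPeriodRat = plusPeriod f →
      ∀ (Lplus Lminus : IwasawaAlgebra 2), IsPollackPair f 2 Lplus Lminus →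
      ∀ (G : IwasawaAlgebra 2) (m : ℕ), iwasawaToPowerSeries 2 G =
        PowerSeries.C ((2 : ℚ_[2]) ^ m * (ϖ : ℚ_[2])) * iwasawaToPowerSeries 2 (kobayashiL 1 Lplus Lminus) →
      MuLambda.mu G = m) :=
  ⟨muAlgebraicAt_of_partner_honda_descentCertificate W A hssW haW hΔ hssA haA hiso hHondaA hSelA htamA,
    fun _γ _ _ f hf _ϖ hϖ Lplus Lminus hP G m hG ↦
      mu_eq_of_isPollackPair_two_of_periodUnit_of_not_two_dvd hϖ (hperW f hf) (hflatW f hf Lplus Lminus hP) G m hG⟩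

end Seed

end Summit.BirchSwinnertonDyer.BirchSwinnertonDyer.Theorems.SignedMuAtTwo

end
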